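import Literature.AlgebraicGeometry.Motives.TannakianDeligneTorusExtendedMumfordTateIsogeny
import Literature.AlgebraicGeometry.Motives.TannakianDeligneTorusExtendedMumfordTateBaseChangePoints
import Mathlib.Algebra.Polynomial.Roots
import HarnessLib

/-!
# MOONEN 2004 (4.8) «if `V` has weight `n ≠ 0` then `MT♯(V) → MT(V)` is an isogeny» ON POINTS: on `M̃T(H)(T)` the multiplier
# satisfies `ν^P = det g` (`P = detType H`), so over a field the fibres of `pr₁ : M̃T(H)(K) → MT(H)(K)` have at most `|P|`
# elements, and the kernel `M̃T(H)(T) ∩ ({1} × T^×)` lies in `μ_P(T)` (Moonen 1999 (1.11), (1.14); Milne AG 2.23)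

[topic AlgebraicGeometry/Motives]

Layer `Literature/AlgebraicGeometry/Motives`, lane `lit-hodgefound` (Track 2 foundations library — Layer A3 «Mumford–Tate
group»; prover seat `lit-hodgefound-p26`, gen 53, row g53-#9). Sequel of g53-#1 `Motives/TannakianDeligneTorusExtendedMumfordTateIsogeny`
(**`det_tmul_one_sub_one_tmul_T_mem_extMumfordTateIdeal : det ⊗ 1 − 1 ⊗ T^P ∈ I_{M̃T(H)}`**, `P = H.detType`, **`detType_ne_zero`**
for `n ≠ 0`, `V ≠ 0`; the scheme-level finiteness `finite_quotientMapₐ_inl_ext`), g53-#3 `…ExtendedMumfordTateBaseChangePoints`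
(`apply_T_eq_zpow : y(T^p) = y(T)^p`, `apply_T_one_ne_zero` for `K`-points of `𝔾_m` over a field), g53-#6
`…ExtendedMumfordTateProjectionPoints` (surjectivity of `pr₁` on `K̄`-points — not imported) and g47 `GLn.point_det : x(det) =
det [x]`. THEOREMS only; no definition, no named fact, no instance, no notation.

## The sources, verbatim

B. Moonen, *An introduction to Mumford–Tate groups* (2004) [Moonen2004MT], (4.8) (as quoted by p34 and g53-#1): "if `V` has
weight `n ≠ 0` then `MT♯(V) → MT(V)` is an isogeny"; B. Moonen, *Notes on Mumford–Tate groups* (1999) [Moonen1999MTNotes], (1.11)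
(«`det ∘ h = Nm^{P}`», the determinant of a Hodge structure is the Tate-type character `Nm^P`, `2P = n · dim V`) and (1.14)
(«The projection onto `GL(V)` gives a surjective homomorphism `M̃T(V) ↠ MT(V)`»); J. S. Milne, *Algebraic Groups* [Milne2017],
2.23 (held text p0129: «a homomorphism … is an isogeny if its kernel is finite and its image is `H`»), 2.8–2.9 («`𝔾_m(R) = R^×`,
`O(𝔾_m) = k[T,T⁻¹]`», «`GL_n` is the functor `R ⇝ GL_n(R)`»), 2.30; P. Deligne, LNM 900 (1982), I §3 [Deligne1982HodgeCycles]
(«`(g₁, g₂) ∈ G ⊆ GL(V) × 𝔾_m`»).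

READING (recorded — RULING 29; no named fact). §1 Points of `𝔾_m` over a field `K ⊃ ℚ` are determined by `y(T) ∈ K^×`
(**`laurentAlgHom_ext_apply_T_one`**), and the `P`-th roots of a constant form a set of at most `|P|` elements
(**`exists_finset_of_zpow_eq`**, Mathlib `Polynomial.nthRoots`). §2 For every `T`-point `(x, y) ∈ M̃T(H)(T)` (any commutative
`ℚ`-algebra `T`): **`apply_det_eq_apply_T_detType : x(det) = y(T^P)`**, i.e. **`det [x] = y(T^P)`** — MOONEN (1.11) `ν^P = det g`
on the extended Mumford–Tate group (g53-#1's relation `det ⊗ 1 − 1 ⊗ T^P ∈ I_{M̃T}` evaluated at the point); in particular the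
KERNEL of `pr₁` on points lies in `μ_P`: **`apply_T_detType_eq_one_of_productMap_triv_mem : (1, y) ∈ M̃T(H)(T) ⟹ y(T^P) = 1`**.
§3 Over a FIELD `K`: **`apply_T_one_zpow_detType_eq_det : y(T)^P = det [x]`**, so two lifts `(x, y), (x, y′)` of the same `x`
differ by a `P`-th root of unity (**`div_apply_T_one_zpow_detType_eq_one`**), and for `n ≠ 0`, `V ≠ 0` (`P ≠ 0`, g53-#1
`detType_ne_zero`) **the fibre of `pr₁ : M̃T(H)(K) → MT(H)(K)` over every `x` is FINITE with at most `|P|` elements**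
(**`finite_setOf_productMap_mem_extMumfordTatePoints`**, **`ncard_setOf_productMap_mem_extMumfordTatePoints_le`**) — with g53-#6
(surjectivity for `K` algebraically closed) this is MOONEN (4.8) «isogeny» on `K̄`-points. What is NOT here: the exact order of
the kernel group scheme (a divisor of `P` depending on `H`).

## Contents (namespace `…Tannakian.DeligneTorus`)

* §1 `laurentAlgHom_ext_apply_T_one`, `exists_finset_of_zpow_eq`.
* §2 **`apply_det_eq_apply_T_detType`**, **`det_pointMatrix_eq_apply_T_detType`**, **`apply_T_detType_eq_one_of_productMap_triv_mem`**.
* §3 **`apply_T_one_zpow_detType_eq_det`**, `apply_T_one_zpow_detType_eq_of_mem_of_mem`, **`div_apply_T_one_zpow_detType_eq_one`**,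
  **`finite_setOf_productMap_mem_extMumfordTatePoints`**, **`ncard_setOf_productMap_mem_extMumfordTatePoints_le`**.
-/

namespace Literature.AlgebraicGeometry.Motives.Tannakian

open TensorProduct WithConv

universe u v w

namespace DeligneTorus

open HodgeStructure

/-! ## §1 Points of `𝔾_m` over a field; `P`-th roots -/

section Gm

variable {K : Type w} [Field K] [Algebra ℚ K]

/-- **A `K`-point of `𝔾_m = spec ℚ[T,T⁻¹]` over a field is determined by its value `y(T) ∈ K^×`** (`y(T^p) = y(T)^p`, g53-#3).
[cite: Milne2017, 2.9 («𝔾_m(R) = R^×»), Ch. 12 Prop. 12.3] -/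
theorem laurentAlgHom_ext_apply_T_one {y y' : LaurentPolynomial ℚ →ₐ[ℚ] K}
    (h : y (LaurentPolynomial.T 1) = y' (LaurentPolynomial.T 1)) : y = y' :=
  AddMonoidAlgebra.algHom_ext (fun p => by
    change y (LaurentPolynomial.T p) = y' (LaurentPolynomial.T p)
    rw [apply_T_eq_zpow y, apply_T_eq_zpow y', h]) (Subsingleton.elim _ _)

omit [Algebra ℚ K] in
/-- In a field the solutions of `z^P = c` (`P ∈ ℤ ∖ {0}`) lie in a finite set with at most `|P|` elements (`μ_P`-torsor or empty).
[cite: Milne2017, 2.9, Ch. 12 («μ_n … the kernel of t ↦ tⁿ»)] -/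
theorem exists_finset_of_zpow_eq (P : ℤ) (hP : P ≠ 0) (c : K) :
    ∃ t : Finset K, t.card ≤ P.natAbs ∧ ∀ z : K, z ^ P = c → z ∈ t := by
  classical
  have hN : 0 < P.natAbs := Int.natAbs_pos.2 hP
  obtain h | h := Int.natAbs_eq P
  · refine ⟨(Polynomial.nthRoots P.natAbs c).toFinset, (Multiset.toFinset_card_le _).trans (Polynomial.card_nthRoots _ _),
      fun z hz => ?_⟩
    rw [h, zpow_natCast] at hz
    exact Multiset.mem_toFinset.2 ((Polynomial.mem_nthRoots hN).2 hz)
  · refine ⟨(Polynomial.nthRoots P.natAbs c⁻¹).toFinset, (Multiset.toFinset_card_le _).trans (Polynomial.card_nthRoots _ _),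
      fun z hz => ?_⟩
    rw [h, zpow_neg, zpow_natCast, inv_eq_iff_eq_inv] at hz
    exact Multiset.mem_toFinset.2 ((Polynomial.mem_nthRoots hN).2 hz)

end Gm

variable {V : Type u} [AddCommGroup V] [Module ℚ V] {n : ℤ} {ι : Type v} [Fintype ι] [DecidableEq ι]

/-! ## §2 MOONEN (1.11) on the extended group: `det g = ν^P` for `(g, ν) ∈ M̃T(H)(T)` -/

section Points

variable {T : Type w} [CommRing T] [Algebra ℚ T]

/-- **`x(det) = y(T^P)` for every `T`-point `(x, y) ∈ M̃T(H)(T)`**, `P = detType H` — the relation `det ⊗ 1 − 1 ⊗ T^P ∈ I_{M̃T(H)}`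
(g53-#1) evaluated at the point: on the extended Mumford–Tate group the multiplier character satisfies `ν^P = det g` (MOONEN
(1.11) `det ∘ h = Nm^P`). [cite: Moonen1999MTNotes, (1.11), (1.14); Moonen2004MT, (4.8); Deligne1982HodgeCycles, I §3 («(g₁, g₂) ∈
G»); Milne2017, 2.30] -/
theorem apply_det_eq_apply_T_detType (H : HodgeStructure V n) (b : Module.Basis ι ℚ V) {x : GLn.Coord ℚ ι →ₐ[ℚ] T}
    {y : LaurentPolynomial ℚ →ₐ[ℚ] T}
    (hxy : letI := GLn.bialgebra ℚ ι; toConv (Algebra.TensorProduct.productMap x y) ∈ extMumfordTatePoints H b T) :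
    x (GLn.det ℚ ι) = y (LaurentPolynomial.T H.detType) := by
  letI := GLn.bialgebra ℚ ι
  haveI : Module.Finite ℚ V := Module.Finite.of_basis b
  have h := (productMap_mem_extMumfordTatePoints_iff H b x y).1 hxy (det_tmul_one_sub_one_tmul_T_mem_extMumfordTateIdeal H b)
  rw [RingHom.mem_ker, map_sub, Algebra.TensorProduct.productMap_apply_tmul, Algebra.TensorProduct.productMap_apply_tmul, map_one,
    map_one, mul_one, one_mul, sub_eq_zero] at h
  exact h

/-- **`det [x] = y(T^P)`** for `(x, y) ∈ M̃T(H)(T)` (g47 `GLn.point_det : x(det) = det [x]`). [cite: Moonen1999MTNotes, (1.11),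
(1.14); Milne2017, 2.8 («GL_n is the functor R ⇝ GL_n(R)»)] -/
theorem det_pointMatrix_eq_apply_T_detType (H : HodgeStructure V n) (b : Module.Basis ι ℚ V) {x : GLn.Coord ℚ ι →ₐ[ℚ] T}
    {y : LaurentPolynomial ℚ →ₐ[ℚ] T}
    (hxy : letI := GLn.bialgebra ℚ ι; toConv (Algebra.TensorProduct.productMap x y) ∈ extMumfordTatePoints H b T) :
    (GLn.pointMatrix x).det = y (LaurentPolynomial.T H.detType) := by
  rw [← GLn.point_det]
  exact apply_det_eq_apply_T_detType H b hxy

/-- **The kernel of `pr₁` on points lies in `μ_P`: `(1, y) ∈ M̃T(H)(T) ⟹ y(T^P) = 1`** (`ε(det) = 1`; g53-#1 §3 `Ker(pr₁) ⊂ {1} ×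
μ_P` as group schemes). [cite: Moonen2004MT, (4.8) («isogeny»); Moonen1999MTNotes, (1.11), (1.14); Milne2017, 2.23 («its kernel
is finite»), Ch. 12] -/
theorem apply_T_detType_eq_one_of_productMap_triv_mem (H : HodgeStructure V n) (b : Module.Basis ι ℚ V)
    {y : LaurentPolynomial ℚ →ₐ[ℚ] T}
    (hy : letI := GLn.bialgebra ℚ ι
      toConv (Algebra.TensorProduct.productMap ((Algebra.ofId ℚ T).comp (Bialgebra.counitAlgHom ℚ (GLn.Coord ℚ ι))) y) ∈
        extMumfordTatePoints H b T) :
    y (LaurentPolynomial.T H.detType) = 1 := by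
  letI := GLn.bialgebra ℚ ι
  have h := apply_det_eq_apply_T_detType H b hy
  rw [AlgHom.comp_apply, Bialgebra.counitAlgHom_apply, GLn.coalgebra_counit_det, map_one] at h
  exact h.symm

end Points

/-! ## §3 Over a field: `y(T)^P = det [x]`, finite fibres of `pr₁` -/

section Field

variable {K : Type w} [Field K] [Algebra ℚ K]

/-- **`y(T)^P = det [x]` for every `K`-point `(x, y) ∈ M̃T(H)(K)` over a field** — the multiplier is a `P`-th root of the
determinant. [cite: Moonen1999MTNotes, (1.11), (1.14); Moonen2004MT, (4.8); Milne2017, 2.9, 2.30] -/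
theorem apply_T_one_zpow_detType_eq_det (H : HodgeStructure V n) (b : Module.Basis ι ℚ V) {x : GLn.Coord ℚ ι →ₐ[ℚ] K}
    {y : LaurentPolynomial ℚ →ₐ[ℚ] K}
    (hxy : letI := GLn.bialgebra ℚ ι; toConv (Algebra.TensorProduct.productMap x y) ∈ extMumfordTatePoints H b K) :
    y (LaurentPolynomial.T 1) ^ H.detType = (GLn.pointMatrix x).det := by
  rw [← apply_T_eq_zpow, det_pointMatrix_eq_apply_T_detType H b hxy]

/-- Two lifts `(x, y), (x, y′) ∈ M̃T(H)(K)` of the same `x` have `y′(T)^P = y(T)^P`. [cite: Moonen2004MT, (4.8); Moonen1999MTNotes,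
(1.14)] -/
theorem apply_T_one_zpow_detType_eq_of_mem_of_mem (H : HodgeStructure V n) (b : Module.Basis ι ℚ V) {x : GLn.Coord ℚ ι →ₐ[ℚ] K}
    {y y' : LaurentPolynomial ℚ →ₐ[ℚ] K}
    (hxy : letI := GLn.bialgebra ℚ ι; toConv (Algebra.TensorProduct.productMap x y) ∈ extMumfordTatePoints H b K)
    (hxy' : letI := GLn.bialgebra ℚ ι; toConv (Algebra.TensorProduct.productMap x y') ∈ extMumfordTatePoints H b K) :
    y' (LaurentPolynomial.T 1) ^ H.detType = y (LaurentPolynomial.T 1) ^ H.detType := by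
  rw [apply_T_one_zpow_detType_eq_det H b hxy, apply_T_one_zpow_detType_eq_det H b hxy']

/-- **MOONEN (4.8) ON POINTS: two lifts of the same `x ∈ MT(H)(K)` to `M̃T(H)(K)` differ by a `P`-th root of unity** —
`(y′(T) / y(T))^P = 1`. [cite: Moonen2004MT, (4.8) («isogeny»); Moonen1999MTNotes, (1.11), (1.14); Milne2017, 2.23, Ch. 12 («μ_n»)] -/
theorem div_apply_T_one_zpow_detType_eq_one (H : HodgeStructure V n) (b : Module.Basis ι ℚ V) {x : GLn.Coord ℚ ι →ₐ[ℚ] K}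
    {y y' : LaurentPolynomial ℚ →ₐ[ℚ] K}
    (hxy : letI := GLn.bialgebra ℚ ι; toConv (Algebra.TensorProduct.productMap x y) ∈ extMumfordTatePoints H b K)
    (hxy' : letI := GLn.bialgebra ℚ ι; toConv (Algebra.TensorProduct.productMap x y') ∈ extMumfordTatePoints H b K) :
    (y' (LaurentPolynomial.T 1) / y (LaurentPolynomial.T 1)) ^ H.detType = 1 := by
  rw [div_zpow, apply_T_one_zpow_detType_eq_of_mem_of_mem H b hxy hxy',
    div_self (zpow_ne_zero _ (apply_T_one_ne_zero y))]

/-- **MOONEN (4.8) «isogeny» ON `K`-POINTS, FINITENESS OF THE FIBRES: for `n ≠ 0` and `V ≠ 0`, over any field `K ⊃ ℚ` the set of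
`y` with `(x, y) ∈ M̃T(H)(K)` is FINITE for every `x`** (the `y(T)` are `P`-th roots of `det [x]`, `P = detType H ≠ 0`, and `y` is
determined by `y(T)`). [cite: Moonen2004MT, (4.8); Moonen1999MTNotes, (1.11), (1.14); Milne2017, 2.23 («its kernel is finite»), 2.9] -/
theorem finite_setOf_productMap_mem_extMumfordTatePoints [Nonempty ι] (H : HodgeStructure V n) (b : Module.Basis ι ℚ V)
    (hn : n ≠ 0) (x : GLn.Coord ℚ ι →ₐ[ℚ] K) :
    letI := GLn.bialgebra ℚ ι
    {y : LaurentPolynomial ℚ →ₐ[ℚ] K |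
      toConv (Algebra.TensorProduct.productMap x y) ∈ extMumfordTatePoints H b K}.Finite := by
  letI := GLn.bialgebra ℚ ι
  obtain ⟨t, -, hmem⟩ := exists_finset_of_zpow_eq H.detType (detType_ne_zero H b hn) (GLn.pointMatrix x).det
  refine Set.Finite.of_finite_image (f := fun y : LaurentPolynomial ℚ →ₐ[ℚ] K => y (LaurentPolynomial.T 1))
    (t.finite_toSet.subset (Set.image_subset_iff.2 fun y hy => hmem _ (apply_T_one_zpow_detType_eq_det H b hy))) ?_
  exact fun y _ y' _ h => laurentAlgHom_ext_apply_T_one h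

/-- **… with AT MOST `|P|` ELEMENTS, `P = detType H` (`2P = n · dim V`).** [cite: Moonen2004MT, (4.8); Moonen1999MTNotes, (1.11)
(«det = Nm^P»), (1.14); Milne2017, 2.23, Ch. 12] -/
theorem ncard_setOf_productMap_mem_extMumfordTatePoints_le [Nonempty ι] (H : HodgeStructure V n) (b : Module.Basis ι ℚ V)
    (hn : n ≠ 0) (x : GLn.Coord ℚ ι →ₐ[ℚ] K) :
    letI := GLn.bialgebra ℚ ι
    {y : LaurentPolynomial ℚ →ₐ[ℚ] K |
      toConv (Algebra.TensorProduct.productMap x y) ∈ extMumfordTatePoints H b K}.ncard ≤ H.detType.natAbs := by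
  letI := GLn.bialgebra ℚ ι
  obtain ⟨t, ht, hmem⟩ := exists_finset_of_zpow_eq H.detType (detType_ne_zero H b hn) (GLn.pointMatrix x).det
  refine (Set.ncard_le_ncard_of_injOn (fun y : LaurentPolynomial ℚ →ₐ[ℚ] K => y (LaurentPolynomial.T 1))
    (fun y hy => hmem _ (apply_T_one_zpow_detType_eq_det H b hy)) (fun y _ y' _ h => laurentAlgHom_ext_apply_T_one h)
    t.finite_toSet).trans ?_
  rw [Set.ncard_coe_finset]
  exact ht

end Field

end DeligneTorus

end Literature.AlgebraicGeometry.Motives.Tannakian
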